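import Mathlib
import HarnessLib
import Summits.Langlands.Langlands.Theses.CMFreeCompletedClosure

/-!
# Birth skeleton (BC3) for crux stmt-Langlands-18472
`Summit.Langlands.Langlands.Theses.CMFreeCompletedClosure.DeRhamClassicality` — line `birth`

Route `route-Langlands-CMFreeCompletedClosure` (`closes : TotallyComplexReduction → TorsionGaloisRep →
Visibility → ProAutomorphy → DeRhamClassicality → AutomorphicPointCompatibility → TemperedPurity →
Langlands`).  The crux (C4, rank 4, "classicality of de Rham points of completed cohomology") says:
for `E` totally complex, `n ≥ 1`, reciprocity data `R`, assuming clause (A) of the summit in every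
rank `n' < n` over `E`: if a `ℤ̄_ℓ`-valued eigensystem `a` of the big Hecke algebra occurs in the
completed cohomology of `GL_n/E` at tame level `𝒰` (`EigensystemOccurs`, mod every `ℓ^{t+1}`) and
`ρ : Γ_E → GL_n(ℚ̄_ℓ)` is irreducible, geometric and associated with `a` off `𝒰.bad`, then for every
compact-level witness `hcpt` there is an L-algebraic cuspidal `π` of `GL_n(𝔸_E)` whose Satake
parameters match the Frobenius polynomials of `ρ` at almost all places.

This file concludes the crux BY NAME from three named stubs, cut along the three mathematically
separate passages of the envisaged proof (the route header's "NOT DECOMPOSED YET: the isobaric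
(non-cuspidal) intermediate of DeRhamClassicality", with the torsion-to-characteristic-`0` passage
isolated in front of the wall):

* `stub_padicallyAutomorphic_of_occurs` — FROM TORSION OCCURRENCE TO A CONTINUOUS POINT OF `𝕋(K^p)`:
  a `ℤ̄_ℓ`-valued eigensystem occurring mod every `ℓ^{t+1}` with which `ρ` is associated makes `ρ`
  `ℓ`-adically automorphic of tame level `𝒰` (`TameLevel.IsPadicallyAutomorphic`: a CONTINUOUS
  `ℚ̄_ℓ`-point `x` of `CompletedCohomologyHeckeAlgebraGLn 𝒰` with `IsAssociated x ρ`).  True in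
  print (comparison of `ℤ/ℓ^s`- and `𝒪/ℓ^s`-coefficients, Shapiro + finiteness of arithmetic
  groups, and the finite coefficient field of `ρ`, `exists_hasQlModel_holds`, which is why `ρ` is a
  hypothesis); size L–XL in Lean.
* `stub_isobaricClassicality` — THE WALL (Fontaine–Mazur on the Hecke side, up to Eisenstein): over
  a totally complex `E`, an irreducible geometric `ρ` that is `ℓ`-adically automorphic of some tame
  level is ISOBARIC-automorphic: there are cuspidal L-algebraic `π_j` on `GL_{m_j}(𝔸_E)`,
  `∑ m_j = n`, whose joint Satake multisets give the Frobenius polynomials of `ρ` almost everywhere.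
  Open problem (known for `GL_2/ℚ`: Emerton, Pan).
* `stub_singleSummand_of_irreducible` — CUSPIDALITY FROM IRREDUCIBILITY: given clause (A) in ranks
  `< n`, an irreducible `ρ` whose Frobenius polynomials are the joint Satake polynomials of cuspidal
  L-algebraic `π_j`, `∑ m_j = n`, `m_j > 0`, has exactly ONE summand (`k = 1`): otherwise each
  `m_j < n`, (A) attaches `ρ_j` to `π_j`, `charpoly ρ(Frob_v) = ∏_j charpoly ρ_j(Frob_v)` a.e.
  (`hasSatakeParamAt_unique_holds`, multiplicativity of `arithFrobPolyOfSatake`), hence everywhere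
  (`absoluteGaloisGroup.frobenius_dense`, `chebotarev_artinRep_holds`), contradicting irreducibility
  by Brauer–Nesbitt (`not_isIrreducible_of_charpoly_eq_mul`).  True; size M–L.

Shape (for `ledger skeleton check`): each stub is `theorem stub_<name> (binders) : <conclusion> := by
sorry`; `_Goal.stub_<name> : Prop := type_of% @stub_<name>` names that statement; the composition
`DeRhamClassicality_of (h₁ : _Goal.stub_padicallyAutomorphic_of_occurs)
(h₂ : _Goal.stub_isobaricClassicality) (h₃ : _Goal.stub_singleSummand_of_irreducible) :
DeRhamClassicality` is proved without `sorry` (three stub calls, `subst k = 1`, `subst m 0 = n`,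
proof-irrelevant transport of the compact-level witness) and concludes the route decl BY NAME; the
last `example` feeds the three stubs to it.  No new definition is introduced: every stub is stated
over the route decl's own vocabulary (`BigHeckeGLn.TameLevel.EigensystemOccurs`,
`BigHeckeGLn.IsAssociatedFamily`, `BigHeckeGLn.TameLevel.IsPadicallyAutomorphic`,
`CuspidalAutomorphicRepData`, `HasSatakeParamAt`, `arithFrobPolyOfSatake`, `FramedGaloisRep`).

Disproof used: none — `ledger crux ls stmt-Langlands-18472` shows no `Disproof.lean` (no workfiles at
all before this line), the item carries one refuter note (rattack 2026-08-17: survives; `S → C` formal,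
hypotheses satisfiable at `n = 1`) and no stub-false / line-dead notes, and
`ledger negatives --problem Langlands` has no entry bearing on this crux.  BC3 probes (planner folder
`bc/probes.lean`, the three stub statements restated verbatim as `def Sᵢ : Prop` in a file WITHOUT
the sorried stubs or the composition, battery `exact? | simpa [Sᵢ] | (unfold Sᵢ; simpa) | aesop` run
UNROLLED, one `example` per tactic, `maxHeartbeats 400000` each): all 24 probes
`Sᵢ → DeRhamClassicality` / `Sᵢ → Langlands` FAIL (`lean check` rc 1, 24 errors, 0 sorries) —
`exact?` 6/6 "could not close the goal", `aesop` 6/6 "failed to prove the goal after exhaustive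
search", `unfold Sᵢ; simpa` 2 × "Tactic `assumption` failed" (S1) + 4 heartbeat time-outs,
`simpa [Sᵢ]` 6 heartbeat time-outs (no tactic closes any probe; verbatim messages in the planner's
NOTES.md).
-/

set_option linter.dupNamespace false

noncomputable section

namespace Summit.Langlands.Langlands.Cruxes.DeRhamClassicality.Birth

open Summit.Langlands.Langlands.Theses.CMFreeCompletedClosure
open scoped BigOperators Topology Manifold Classical MeasureTheory ProbabilityTheory Matrix InnerProductSpace ComplexConjugate ContinuousMap
open Filter Set Function TopologicalSpace MeasureTheory
open Literature.NumberTheory.GaloisRepresentations Literature.NumberTheory.Automorphic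

/-! ## 1. The three stubs -/

/-- **STUB 1 — FROM TORSION OCCURRENCE AT ALL DEPTHS TO A CONTINUOUS `ℚ̄_ℓ`-POINT OF `𝕋(K^p)`.**
For any number field `E`, tame level `𝒰` of `GL_n/E` at `ℓ` and `ℤ̄_ℓ`-valued family `a`
(`ℤ̄_ℓ = ` the valuation ring of `ℚ̄_ℓ = PadicAlgCl ℓ`): if the eigensystem `T_{v,i} ↦ a v i`
(`v ∉ S`, `1 ≤ i ≤ n`) occurs in the completed cohomology `H̃^i(K^p)_{ℤ̄_ℓ}` (`EigensystemOccurs`: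
for every `t` a simultaneous eigenclass in some `H^i(X_{U_r}, ℤ̄_ℓ/ℓ^{t+1})` with exact annihilator
`(ℓ^{t+1})`) and `ρ : Γ_E → GL_n(ℚ̄_ℓ)` is associated with `a` off `S` (`IsAssociatedFamily`:
unramified, `charpoly ρ(Frob_v) = P_v(a)`), then `ρ` is `ℓ`-ADICALLY AUTOMORPHIC of tame level `𝒰`
(`TameLevel.IsPadicallyAutomorphic`): `T_{v,i} ↦ a v i` extends to a CONTINUOUS ring homomorphism
`x : 𝕋(K^p) → ℚ̄_ℓ` with `IsAssociated x ρ`.  Proof plan (every step in print): a relation among the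
`T_{v,i}` vanishing on all `H^•(X_{U_r}, ℤ/ℓ^s)` vanishes on `H^i(X_{U_r}, 𝒪_{E'}/ℓ^s)`
(`𝒪_{E'}` finite free over `ℤ_ℓ`: additivity) and on `H^i(X_{U_r}, ℤ̄_ℓ/ℓ^s)` (filtered colimit,
Shapiro + finiteness of arithmetic groups), so it kills the eigenclass and its value at `a` lies in
`(ℓ^{t+1})` for every `t`, i.e. is `0`; the same estimate is the continuity; the values `a v i`,
`1 ≤ i ≤ n`, lie in ONE finite `E'/ℚ_ℓ` because they are, up to the units `± q_v^{i(i-1)/2}`, the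
coefficients of `charpoly ρ(Frob_v)` and `ρ` has a model over a finite extension
(`exists_hasQlModel_holds`), so the uniformly continuous `x` extends to the closure `𝕋(K^p)` with
values in the complete `𝒪_{E'} ⊂ ℚ̄_ℓ`; `x(T_{v,0}) = 1`, `x(T_{v,n}⁻¹) = (a v n)⁻¹` (`a v n` a unit:
`T_{v,n}` is invertible).  Why it might fail (as typed): only through the `ℤ/ℓ^s` vs `ℤ̄_ℓ/ℓ^s`
coefficient comparison hidden in the two tree definitions (`𝕋` is built on `ZMod (ℓ^s)`-cohomology,
`EigensystemOccurs` on `modPow ℤ̄_ℓ ℓ (t+1)`-cohomology).  Size: L–XL (Borel–Serre type finiteness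
is not in the tree).  Leans on: `BigHeckeGLn.TameLevel.EigensystemOccurs`, `eigensystemOccurs_iff`,
`CompletedCohomologyHeckeAlgebraGLn`, `TameLevel.heckeT`, `BigHeckeGLn.heckeFrobPoly`,
`levelCohomologyIso`, `exists_hasQlModel_holds` (tree); Mathlib `groupCohomology`.
[cite: CalegariEmerton2011, §8] [cite: GeeNewton2020, §2.1.3, Def. 2.1.5, Lemma 2.1.8 and §3.3, Def. 3.3.4] [cite: Scholze2015, Rem. V.4.5] -/
theorem stub_padicallyAutomorphic_of_occurs
    (E : Type) [Field E] [NumberField E] (n ℓ : ℕ) [Fact ℓ.Prime]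
    (𝒰 : Literature.NumberTheory.Automorphic.BigHeckeGLn.TameLevel n E ℓ) (i : ℕ)
    (a : IsDedekindDomain.HeightOneSpectrum (NumberField.RingOfIntegers E) → ℕ →
      (Valued.v : Valuation (PadicAlgCl ℓ) NNReal).valuationSubring)
    (hocc : 𝒰.EigensystemOccurs (Valued.v : Valuation (PadicAlgCl ℓ) NNReal).valuationSubring a i)
    (ρ : Literature.NumberTheory.GaloisRepresentations.FramedGaloisRep E (PadicAlgCl ℓ) n)
    (hassoc : Literature.NumberTheory.Automorphic.BigHeckeGLn.IsAssociatedFamily n 𝒰.bad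
      (fun v j => ((a v j : (Valued.v : Valuation (PadicAlgCl ℓ) NNReal).valuationSubring) :
        PadicAlgCl ℓ)) ρ) :
    𝒰.IsPadicallyAutomorphic ρ := by
  sorry

/-- **STUB 2 — THE WALL: GEOMETRIC `ℓ`-ADICALLY AUTOMORPHIC POINTS ARE CLASSICAL UP TO EISENSTEIN
(Fontaine–Mazur on the Hecke side over a totally complex field).**  For `E` totally complex,
`n ≥ 1`, reciprocity data `R` (which pins Fontaine's `D_pst` in `IsGeometricFramed`), `ι : ℚ̄_ℓ ≃ ℂ`
and a tame level `𝒰`: an IRREDUCIBLE `ρ : Γ_E → GL_n(ℚ̄_ℓ)` which is geometric (a.e. unramified, de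
Rham above `ℓ`) and `ℓ`-adically automorphic of tame level `𝒰` (a continuous `ℚ̄_ℓ`-point of the
completed-cohomology Hecke algebra, the output of Stub 1) is ISOBARIC-AUTOMORPHIC: there are
`k` ranks `m_j > 0` with `∑_j m_j = n` and cuspidal L-algebraic `π_j` on `GL_{m_j}(𝔸_E)` (typed by
compact-level witnesses `hc j`) such that at almost every finite `v` each `π_j` is unramified with
Satake parameter `α_j` and `charpoly ρ(Frob_v) = ∏_{a ∈ ∑_j α_j} (X - ι⁻¹(a⁻¹))`
(`arithFrobPolyOfSatake ι q_v 1 (∑_j α_j)`: the Satake multiset of the isobaric sum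
`π_1 ⊞ ⋯ ⊞ π_k`, unitary induction, L-normalisation — L-algebraicity is summand-wise).  Cuspidality
(`k = 1`) is NOT claimed here: it is Stub 3's job, fed by clause (A) in lower ranks.  This is the
hardest stub and carries every risk named in the crux's why-it-might-fail: classicality of de Rham
points of completed cohomology is known only for `GL_2/ℚ` (Emerton; Pan, weights `(0,0)` and
`k ≥ 2`), there is no `p`-adic local Langlands for `GL_n(E_v)`, `E_v ≠ ℚ_p`, to run Emerton's
local–global argument, and an irregular (non-cohomological) de Rham point has no companion-form /
overconvergent receptacle; handles: Hansen's eigenvariety `𝒳_{K^p}` through `x` (Conj. 1.2.3),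
Sen theory / infinitesimal character of the `ρ`-part of `H̃^•`, patching + locally analytic vectors
(Pan) in the few cases where the local theory exists.  True if reciprocity (B) holds in rank `n` over
`E` (then `k = 1`), so it is a consequence of the summit, strictly weaker in appearance (isobaric
conclusion, pro-automorphy hypothesis).  Size: open-problem.  Leans on:
`BigHeckeGLn.TameLevel.IsPadicallyAutomorphic`, `Summit.Langlands.IsGeometricFramed`,
`CuspidalAutomorphicRepData`, `AutomorphicRepData.HasSatakeParamAt`, `arithFrobPolyOfSatake` (tree).
[cite: Emerton2011LocalGlobal, Thm. 1.2.4] [cite: Pan2022, Thm. 1.0.5] [cite: HansenUniversalEigenvarieties2017, Conj. 1.2.3] [cite: GeeNewton2020, §3.3] [cite: FontaineMazurGeometric1995, Conj. 1] -/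
theorem stub_isobaricClassicality
    (E : Type) [Field E] [NumberField E] (hE : NumberField.IsTotallyComplex E) (n : ℕ) (hn : 0 < n)
    (R : Summit.Langlands.ReciprocityData E) (ℓ : ℕ) [Fact ℓ.Prime] (ι : PadicAlgCl ℓ ≃+* ℂ)
    (𝒰 : Literature.NumberTheory.Automorphic.BigHeckeGLn.TameLevel n E ℓ)
    (ρ : Literature.NumberTheory.GaloisRepresentations.FramedGaloisRep E (PadicAlgCl ℓ) n)
    (hirr : ρ.toGaloisRep.IsIrreducible) (hgeo : Summit.Langlands.IsGeometricFramed R ρ)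
    (hpa : 𝒰.IsPadicallyAutomorphic ρ) :
    ∃ (k : ℕ) (m : Fin k → ℕ)
      (hc : ∀ j, Literature.NumberTheory.Automorphic.isCompact_glFiniteIntegralLevel (m j) E)
      (π : ∀ j, Literature.NumberTheory.Automorphic.CuspidalAutomorphicRepData (m j) E (hc j)),
      (∀ j, 0 < m j) ∧ ∑ j, m j = n ∧ (∀ j, (π j).1.IsLAlgebraic) ∧
        ∀ᶠ v : IsDedekindDomain.HeightOneSpectrum (NumberField.RingOfIntegers E) in Filter.cofinite,
          ∃ α : Fin k → Multiset ℂ, (∀ j, (π j).1.HasSatakeParamAt v (α j)) ∧ ρ.IsUnramifiedAt v ∧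
            ρ.HasFrobCharpolyAt v
              (Literature.NumberTheory.Automorphic.arithFrobPolyOfSatake ι v.residueCard 1 (∑ j, α j)) := by
  sorry

/-- **STUB 3 — CUSPIDALITY FROM IRREDUCIBILITY, GIVEN RECIPROCITY (A) IN LOWER RANKS (no Frobenius
splitting).**  For any number field `E`, `n ≥ 1`, reciprocity data `R`, assuming clause (A) of the
summit in every rank `n' < n` over `E`: if `ρ : Γ_E → GL_n(ℚ̄_ℓ)` is IRREDUCIBLE and its Frobenius
polynomials are, at almost every place, the joint Satake polynomials
`arithFrobPolyOfSatake ι q_v 1 (∑_j α_j)` of cuspidal L-algebraic `π_j` on `GL_{m_j}(𝔸_E)`,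
`j < k`, `m_j > 0`, `∑_j m_j = n`, then `k = 1`.  Proof (in print, every ingredient in the tree): if
`k ≥ 2` every `m_j < n`, so (A) gives irreducible geometric `ρ_j : Γ_E → GL_{m_j}(ℚ̄_ℓ)`
corresponding to `π_j`; Satake parameters are unique (`hasSatakeParamAt_unique_holds`) and
`arithFrobPolyOfSatake ι q 1` is multiplicative in the multiset (`Multiset.prod_add`), so
`charpoly ρ(Frob_v) = ∏_j charpoly ρ_j(Frob_v)` for almost all `v`; Frobenii off a finite set are
dense (`absoluteGaloisGroup.frobenius_dense` from the PROVED `chebotarev_artinRep_holds`) and both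
sides are continuous class functions into the Hausdorff `ℚ̄_ℓ[X]_{≤ n}`, so the identity holds on
all of `Γ_E`; grouping `j = 0` against the block sum of the others, Brauer–Nesbitt
(`not_isIrreducible_of_charpoly_eq_mul`) contradicts the irreducibility of `ρ`; `k = 0` contradicts
`0 < n`.  Why it might fail: it does not mathematically; the Lean cost is the block-sum framed
representation of a `Fin`-family and the density/continuity passage (cf. the landed
`FramedGaloisRep.nonempty_equiv_of_hasFrobCharpolyAt_eventually`).  Size: M–L.  Leans on:
`Summit.Langlands.AutomorphicToGalois`, `Summit.Langlands.Corresponds`,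
`AutomorphicRepData.hasSatakeParamAt_unique_holds`, `arithFrobPolyOfSatake_one`,
`absoluteGaloisGroup.frobenius_dense`, `chebotarev_artinRep_holds`,
`Literature.RepresentationTheory.Semisimple.not_isIrreducible_of_charpoly_eq_mul` (tree).
[cite: SerreAbelianLadic1968, Ch. I §2.2, Cor. 2 (a) and §2.3] [cite: BourbakiAlgebreVIII2012, VIII § 20 n° 6, Thm. 2, Cor. 1] [cite: JacquetShalika1981, Thm. 4.4] -/
theorem stub_singleSummand_of_irreducible
    (E : Type) [Field E] [NumberField E] (n : ℕ) (hn : 0 < n)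
    (R : Summit.Langlands.ReciprocityData E)
    (ihA : ∀ n' < n, 0 < n' →
      ∀ hcpt' : Literature.NumberTheory.Automorphic.isCompact_glFiniteIntegralLevel n' E,
        Summit.Langlands.AutomorphicToGalois n' R hcpt')
    (ℓ : ℕ) [Fact ℓ.Prime] (ι : PadicAlgCl ℓ ≃+* ℂ)
    (ρ : Literature.NumberTheory.GaloisRepresentations.FramedGaloisRep E (PadicAlgCl ℓ) n)
    (hirr : ρ.toGaloisRep.IsIrreducible)
    (k : ℕ) (m : Fin k → ℕ)
    (hc : ∀ j, Literature.NumberTheory.Automorphic.isCompact_glFiniteIntegralLevel (m j) E)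
    (π : ∀ j, Literature.NumberTheory.Automorphic.CuspidalAutomorphicRepData (m j) E (hc j))
    (hmpos : ∀ j, 0 < m j) (hsum : ∑ j, m j = n) (hLalg : ∀ j, (π j).1.IsLAlgebraic)
    (hmatch : ∀ᶠ v : IsDedekindDomain.HeightOneSpectrum (NumberField.RingOfIntegers E) in
      Filter.cofinite, ∃ α : Fin k → Multiset ℂ, (∀ j, (π j).1.HasSatakeParamAt v (α j)) ∧
        ρ.IsUnramifiedAt v ∧ ρ.HasFrobCharpolyAt v
          (Literature.NumberTheory.Automorphic.arithFrobPolyOfSatake ι v.residueCard 1 (∑ j, α j))) :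
    k = 1 := by
  sorry

/-! ## 2. The stub statements as named `Prop`s (literally the types of the stubs; no `sorry` inherited) -/

namespace _Goal

/-- The statement of `stub_padicallyAutomorphic_of_occurs`, as a named `Prop` (literally its type). [folklore] -/
def stub_padicallyAutomorphic_of_occurs : Prop :=
  type_of% @Summit.Langlands.Langlands.Cruxes.DeRhamClassicality.Birth.stub_padicallyAutomorphic_of_occurs

/-- The statement of `stub_isobaricClassicality`, as a named `Prop` (literally its type). [folklore] -/
def stub_isobaricClassicality : Prop :=
  type_of% @Summit.Langlands.Langlands.Cruxes.DeRhamClassicality.Birth.stub_isobaricClassicality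

/-- The statement of `stub_singleSummand_of_irreducible`, as a named `Prop` (literally its type). [folklore] -/
def stub_singleSummand_of_irreducible : Prop :=
  type_of% @Summit.Langlands.Langlands.Cruxes.DeRhamClassicality.Birth.stub_singleSummand_of_irreducible

end _Goal

/-! ## 3. The composition (kernel-checked, no `sorry`): POINT → ISOBARIC CLASSICALITY → ONE SUMMAND → crux by name -/

/-- **The crux from the three stubs.**  Given the crux data (`E` totally complex, `n ≥ 1`, `R`,
clause (A) below `n`, a `ℤ̄_ℓ`-eigensystem `a` occurring at tame level `𝒰`, an irreducible geometric
`ρ` associated with `a`, a compact-level witness `hcpt`): STUB 1 makes `ρ` `ℓ`-adically automorphic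
of tame level `𝒰`; STUB 2 (the wall) produces an isobaric decomposition into cuspidal L-algebraic
`π_j` whose joint Satake multisets give the Frobenius polynomials of `ρ`; STUB 3 forces a single
summand, so `m 0 = n` and `π 0` is the sought cuspidal `π` (the compact-level witness `hc 0` is
transported to `hcpt` by proof irrelevance, `∑_{j : Fin 1} α_j = α_0`).  Hypotheses are, by name, the
statements of the three stubs; the conclusion is the route decl `DeRhamClassicality`. [folklore] -/
theorem DeRhamClassicality_of (h₁ : _Goal.stub_padicallyAutomorphic_of_occurs)
    (h₂ : _Goal.stub_isobaricClassicality) (h₃ : _Goal.stub_singleSummand_of_irreducible) :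
    DeRhamClassicality := by
  intro E _ _ hE n hn R ihA ℓ _ ι 𝒰 i a hocc ρ hirr hgeo hassoc hcpt
  -- STUB 1: a continuous `ℚ̄_ℓ`-point of `𝕋(K^p)` associated with `ρ`
  have hpa : 𝒰.IsPadicallyAutomorphic ρ := h₁ E n ℓ 𝒰 i a hocc ρ hassoc
  -- STUB 2: classicality up to Eisenstein (isobaric decomposition)
  obtain ⟨k, m, hc, π, hmpos, hsum, hLalg, hmatch⟩ := h₂ E hE n hn R ℓ ι 𝒰 ρ hirr hgeo hpa
  -- STUB 3: irreducibility + (A) below `n` force one summand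
  have hk : k = 1 := h₃ E n hn R ihA ℓ ι ρ hirr k m hc π hmpos hsum hLalg hmatch
  subst hk
  have hm0 : m 0 = n := by simpa using hsum
  subst hm0
  refine ⟨π 0, hLalg 0, hmatch.mono ?_⟩
  rintro v ⟨α, hα, hur, hcp⟩
  exact ⟨α 0, hα 0, hur, by simpa using hcp⟩

/-- By-name sanity check (an `example`, so it is not a declaration of the file): the three stubs feed
the composition as they stand. -/
example : DeRhamClassicality :=
  DeRhamClassicality_of stub_padicallyAutomorphic_of_occurs stub_isobaricClassicality
    stub_singleSummand_of_irreducible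

end Summit.Langlands.Langlands.Cruxes.DeRhamClassicality.Birth

end
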